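import Mathlib.Analysis.SpecialFunctions.Pow.Real
import HarnessLib

/-!
# Stub `stub_calGrowth` — the calibration bound is sub-Gaussian at every rate
(crux `LeeYang.LeeyangThesis`, line Sketch, card telegraph-string; calibration sub-programme,
RH-free real analysis)

For `u_L ≥ 1` and `b > 0` there is a constant `C` with
`B(ρ) := (max u_L (2 + ρ + 2ρ²) / u_L)^ρ (1 + 2ρ) ≤ C e^{b ρ²}` for all `ρ ≥ 0`
(indeed `log B(ρ) = O(ρ log ρ)`).

Proof. Put `Q(ρ) = u_L + 2 + ρ + 2ρ²`; then `0 ≤ max u_L (2 + ρ + 2ρ²) / u_L ≤ Q(ρ)` (as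
`u_L ≥ 1`), so `B(ρ) ≤ Q(ρ)^ρ (1 + 2ρ)`. From `Q(ρ) ≤ (u_L + 2)(1 + ρ)²` and
`log y = log (t y) - log t ≤ t y - 1 - log t` (`t > 0`) one gets `log Q(ρ) ≤ ε ρ + c` for every
`ε > 0`; with `ε = b/4` and `c ρ ≤ (b/4) ρ² + c²/b` this gives `ρ log Q(ρ) ≤ (b/2) ρ² + c²/b`,
i.e. `Q(ρ)^ρ ≤ e^{c²/b} e^{(b/2) ρ²}`. Finally
`1 + 2ρ ≤ (1 + 2/b)(1 + (b/2) ρ²) ≤ (1 + 2/b) e^{(b/2) ρ²}`, and the two factors `e^{(b/2) ρ²}`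
multiply to `e^{b ρ²}`.
-/

noncomputable section

set_option linter.dupNamespace false

namespace Summit.RiemannHypothesis.RiemannHypothesis.Theorems.LeeYangTelegraphString

/-- Linear bound on the logarithm of the quadratic `Q(ρ) = K + ρ + 2ρ²` (`K ≥ 2`): for every
`ε > 0` there is `c` with `log Q(ρ) ≤ ε ρ + c` for all `ρ ≥ 0`. -/
theorem calGrowth_log_quad_le {K ε : ℝ} (hK : 2 ≤ K) (hε : 0 < ε) :
    ∃ c : ℝ, ∀ ρ : ℝ, 0 ≤ ρ → Real.log (K + ρ + 2 * ρ ^ 2) ≤ ε * ρ + c := by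
  refine ⟨Real.log K + ε - 2 - 2 * Real.log (ε / 2), fun ρ hρ => ?_⟩
  have hKpos : 0 < K := by linarith
  have h1ρ : 0 < 1 + ρ := by linarith
  have hρ2 : 0 ≤ ρ ^ 2 := sq_nonneg ρ
  have hQpos : 0 < K + ρ + 2 * ρ ^ 2 := by linarith
  have ht : 0 < ε / 2 := by positivity
  -- `Q ≤ K (1 + ρ)²`
  have hQle : K + ρ + 2 * ρ ^ 2 ≤ K * (1 + ρ) ^ 2 := by
    nlinarith [mul_nonneg (sub_nonneg.2 hK) hρ2, mul_nonneg hKpos.le hρ]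
  have hlogQ : Real.log (K + ρ + 2 * ρ ^ 2) ≤ Real.log K + 2 * Real.log (1 + ρ) := by
    calc Real.log (K + ρ + 2 * ρ ^ 2) ≤ Real.log (K * (1 + ρ) ^ 2) := Real.log_le_log hQpos hQle
      _ = Real.log K + 2 * Real.log (1 + ρ) := by
          rw [Real.log_mul hKpos.ne' (pow_pos h1ρ 2).ne', Real.log_pow]
          norm_num
  -- `log (1 + ρ) = log (t (1 + ρ)) - log t ≤ t (1 + ρ) - 1 - log t` with `t = ε / 2`
  have hlog1 : Real.log (1 + ρ) ≤ ε / 2 * (1 + ρ) - 1 - Real.log (ε / 2) := by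
    have h := Real.log_le_sub_one_of_pos (mul_pos ht h1ρ)
    rw [Real.log_mul ht.ne' h1ρ.ne'] at h
    linarith
  linarith [hlogQ, hlog1]

/-- Sub-Gaussian growth of `Q(ρ)^ρ`, `Q(ρ) = K + ρ + 2ρ²` (`K ≥ 2`): for every `b > 0` there is
`C` with `Q(ρ)^ρ ≤ C e^{(b/2) ρ²}` for all `ρ ≥ 0`. -/
theorem calGrowth_quad_rpow_le {K b : ℝ} (hK : 2 ≤ K) (hb : 0 < b) :
    ∃ C : ℝ, ∀ ρ : ℝ, 0 ≤ ρ → (K + ρ + 2 * ρ ^ 2) ^ ρ ≤ C * Real.exp (b / 2 * ρ ^ 2) := by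
  obtain ⟨c, hc⟩ := calGrowth_log_quad_le hK (by positivity : 0 < b / 4)
  refine ⟨Real.exp (c ^ 2 / b), fun ρ hρ => ?_⟩
  have hb0 : b ≠ 0 := hb.ne'
  have hKpos : 0 < K := by linarith
  have hρ2 : 0 ≤ ρ ^ 2 := sq_nonneg ρ
  have hQpos : 0 < K + ρ + 2 * ρ ^ 2 := by linarith
  rw [Real.rpow_def_of_pos hQpos, ← Real.exp_add, Real.exp_le_exp]
  -- `ρ log Q ≤ (b/4) ρ² + c ρ ≤ (b/4) ρ² + ((b/4) ρ² + c²/b)`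
  have h1 : Real.log (K + ρ + 2 * ρ ^ 2) * ρ ≤ (b / 4 * ρ + c) * ρ :=
    mul_le_mul_of_nonneg_right (hc ρ hρ) hρ
  have h2 : c * ρ ≤ b / 4 * ρ ^ 2 + c ^ 2 / b := by
    have h3 : 0 ≤ (b / 2 * ρ - c) ^ 2 / b := by positivity
    have e : (b / 2 * ρ - c) ^ 2 / b = b / 4 * ρ ^ 2 + c ^ 2 / b - c * ρ := by
      field_simp
      ring
    linarith
  nlinarith [h1, h2]

/-- `1 + 2ρ ≤ (1 + 2/b) e^{(b/2) ρ²}` for `b > 0`. -/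
theorem calGrowth_linear_le {b : ℝ} (hb : 0 < b) (ρ : ℝ) :
    1 + 2 * ρ ≤ (1 + 2 / b) * Real.exp (b / 2 * ρ ^ 2) := by
  have hb0 : b ≠ 0 := hb.ne'
  have h1 : b / 2 * ρ ^ 2 + 1 ≤ Real.exp (b / 2 * ρ ^ 2) := Real.add_one_le_exp _
  have h2 : 2 * ρ ≤ b / 2 * ρ ^ 2 + 2 / b := by
    have h3 : 0 ≤ b / 2 * (ρ - 2 / b) ^ 2 := by positivity
    have e : b / 2 * (ρ - 2 / b) ^ 2 = b / 2 * ρ ^ 2 + 2 / b - 2 * ρ := by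
      field_simp
      ring
    linarith
  have h4 : 0 ≤ ρ ^ 2 := sq_nonneg ρ
  have e : (1 + 2 / b) * (b / 2 * ρ ^ 2 + 1) = b / 2 * ρ ^ 2 + 1 + ρ ^ 2 + 2 / b := by
    field_simp
    ring
  calc 1 + 2 * ρ ≤ b / 2 * ρ ^ 2 + 1 + ρ ^ 2 + 2 / b := by linarith
    _ = (1 + 2 / b) * (b / 2 * ρ ^ 2 + 1) := e.symm
    _ ≤ (1 + 2 / b) * Real.exp (b / 2 * ρ ^ 2) :=
        mul_le_mul_of_nonneg_left h1 (by positivity)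

/-- The calibration bound `B(ρ) = (max u_L (2 + ρ + 2ρ²) / u_L)^ρ (1 + 2ρ)` (`u_L ≥ 1`) is
sub-Gaussian at every rate: for each `b > 0` there is `C` with `B(ρ) ≤ C e^{b ρ²}` for all
`ρ ≥ 0`. -/
theorem stub_calGrowth : ∀ (uL b : ℝ), 1 ≤ uL → 0 < b → ∃ C : ℝ, ∀ ρ : ℝ, 0 ≤ ρ →
    (max uL (2 + ρ + 2 * ρ ^ 2) / uL) ^ ρ * (1 + 2 * ρ) ≤ C * Real.exp (b * ρ ^ 2) := by
  intro uL b huL hb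
  obtain ⟨C₁, hC₁⟩ := calGrowth_quad_rpow_le (K := uL + 2) (by linarith) hb
  refine ⟨C₁ * (1 + 2 / b), fun ρ hρ => ?_⟩
  have huLpos : 0 < uL := by linarith
  have hρ2 : 0 ≤ ρ ^ 2 := sq_nonneg ρ
  have hm0 : 0 ≤ max uL (2 + ρ + 2 * ρ ^ 2) := le_max_of_le_left huLpos.le
  have hbase0 : 0 ≤ max uL (2 + ρ + 2 * ρ ^ 2) / uL := div_nonneg hm0 huLpos.le
  -- the base is at most `Q(ρ) = u_L + 2 + ρ + 2ρ²`
  have hbase : max uL (2 + ρ + 2 * ρ ^ 2) / uL ≤ uL + 2 + ρ + 2 * ρ ^ 2 :=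
    calc max uL (2 + ρ + 2 * ρ ^ 2) / uL ≤ max uL (2 + ρ + 2 * ρ ^ 2) := div_le_self hm0 huL
      _ ≤ uL + 2 + ρ + 2 * ρ ^ 2 := max_le (by linarith) (by linarith)
  have hpow : (max uL (2 + ρ + 2 * ρ ^ 2) / uL) ^ ρ ≤ C₁ * Real.exp (b / 2 * ρ ^ 2) :=
    (Real.rpow_le_rpow hbase0 hbase hρ).trans (hC₁ ρ hρ)
  have hlin := calGrowth_linear_le hb ρ
  have h0 : 0 ≤ (max uL (2 + ρ + 2 * ρ ^ 2) / uL) ^ ρ := Real.rpow_nonneg hbase0 ρ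
  have h0' : 0 ≤ 1 + 2 * ρ := by linarith
  have hexp : Real.exp (b * ρ ^ 2) = Real.exp (b / 2 * ρ ^ 2) * Real.exp (b / 2 * ρ ^ 2) := by
    rw [← Real.exp_add]
    congr 1
    ring
  calc (max uL (2 + ρ + 2 * ρ ^ 2) / uL) ^ ρ * (1 + 2 * ρ)
      ≤ C₁ * Real.exp (b / 2 * ρ ^ 2) * ((1 + 2 / b) * Real.exp (b / 2 * ρ ^ 2)) :=
        mul_le_mul hpow hlin h0' (h0.trans hpow)
    _ = C₁ * (1 + 2 / b) * Real.exp (b * ρ ^ 2) := by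
        rw [hexp]
        ring

end Summit.RiemannHypothesis.RiemannHypothesis.Theorems.LeeYangTelegraphString

end
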